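import Summits.AtomisticToContinuum.BoseEinsteinCondensation.Theorems.BECDyadicChainingBaseCoherentMassSineGapAux
import Literature.MathematicalPhysics.QuantumManyBody.PeriodicBoseGasLocalization

/-!
# Route `BECDyadicChaining` — crux `BaseCoherentMass` (stmt-AtomisticToContinuum-13193), stub
`stub_sineGap`: the one-body Dirichlet spectral gap of the cube in sine form

The registered stub `stub_sineGap` of the line `registered` of the crux
`Summit.AtomisticToContinuum.BoseEinsteinCondensation.Theses.BECDyadicChaining.BaseCoherentMass`
(the one-body spectral input of its FREE-GAS branch): for `L > 0` and `f ∈ C¹(ℝ³; ℂ)` vanishing off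
the open box `Λ_L = (0,L)³`,

`6 ∫|f|² ≤ (L/π)² ∫|∇f|² + 3 |⟨s, f⟩|²`, `s(x) = ∏_k √(2/L) sin(πx_k/L)`,

i.e. `‖∇f‖² ≥ (3π²/L²)‖f‖² + (3π²/L²)‖f - ⟨s,f⟩s‖²`: the Dirichlet Laplacian of the cube has ground
state `s`, ground energy `3π²/L²` and gap `3π²/L²` up to the first excited level `6π²/L²`. Sharp
(equality for `s` and for the first excited modes).

Proof (folklore; the Neumann analogue is [LSSY2005, Ch. 2, after (2.50)], proved in the tree in
`NeumannBoxParseval.lean`). On the coordinate cube `[0,ℓ]³` with the product sine modes `u_k`,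
`k ∈ ℕ³`, and `b_k = ∫ u_k g` (`BECDyadicChainingBaseCoherentMassSineGapAux.lean`): sine Parseval
`∑_k |b_k|² = ∫|g|²` and the Dirichlet form identity `∑_k (π/ℓ)²|k|²|b_k|² = ∫|∇g|²` for `g ∈ C¹`
vanishing off the open cube; `b_k = 0` when some `kⱼ = 0` (`sin 0 = 0`), `|(1,1,1)|² = 3`, and
`|k|² ≥ 6` for every other `k ∈ ℕ₊³` (`sineGap_six_le_sum_sq`), so termwise
`6|b_k|² ≤ (ℓ/π)²(π/ℓ)²|k|²|b_k|² + 3·1[k = (1,1,1)]|b_k|²` and summing in `ℝ≥0∞` gives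
`sineGap_cube`. Transfer to `Space = ℝ³` (`stub_sineGap`): `f = 0` off `Λ_L`, so `∫|f|²` and `∫ s f`
live on the box, `∫_Λ|∇f|² ≤ ∫|∇f|²`, and the box is the coordinate cube up to a null set
(`setLIntegral_box_eq_lintegral_Icc`, `setIntegral_box_eq_integral_Icc`, `fderiv_comp_toLp_single`).

## References

* [LSSY2005] E. H. Lieb, R. Seiringer, J. P. Solovej, J. Yngvason, *The Mathematics of the Bose Gas
  and its Condensation*, Birkhäuser 2005: Ch. 2, after (2.50).
-/

noncomputable section

namespace Summit.AtomisticToContinuum.BoseEinsteinCondensation.Theorems.BaseCoherentMass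

open Real MeasureTheory Set
open scoped ENNReal NNReal
open Literature.MathematicalPhysics.QuantumManyBody.NeumannBox
open Literature.MathematicalPhysics.QuantumManyBody.BoseGas

variable {d : ℕ} {ℓ : ℝ}

/-! ### The Dirichlet gap of the cube `[0,ℓ]³` in sine form -/

/-- For a multi-index with a zero entry the product sine mode vanishes identically, so the
corresponding coefficient is zero. [folklore] -/
theorem sineGap_coef_eq_zero_of_apply_eq_zero (ℓ : ℝ) (g : (Fin d → ℝ) → ℂ) {k : Fin d → ℕ}
    {j : Fin d} (hk : k j = 0) :
    ∫ y in Icc (0 : Fin d → ℝ) (fun _ => ℓ),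
        ((∏ j, Real.sqrt (2 / ℓ) * Real.sin ((k j) * π / ℓ * (y j)) : ℝ) : ℂ) * g y = 0 := by
  have h0 : ∀ y : Fin d → ℝ, (∏ j, Real.sqrt (2 / ℓ) * Real.sin ((k j) * π / ℓ * (y j))) = 0 :=
    fun y => Finset.prod_eq_zero (Finset.mem_univ j) (by rw [hk]; simp)
  simp_rw [h0, Complex.ofReal_zero, zero_mul, integral_zero]

/-- For `k ∈ ℕ₊³` other than `(1,1,1)`: `|k|² ≥ 6` (some entry is `≥ 2`, the others `≥ 1`).
[folklore] -/
theorem sineGap_six_le_sum_sq {k : Fin 3 → ℕ} (hk : ∀ j, k j ≠ 0) (hk1 : k ≠ 1) :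
    6 ≤ ∑ i, k i ^ 2 := by
  obtain ⟨j, hj⟩ : ∃ j, k j ≠ (1 : Fin 3 → ℕ) j := Function.ne_iff.1 hk1
  rw [Pi.one_apply] at hj
  have h2 : 2 ≤ k j := by have := hk j; omega
  have h4 : 4 ≤ k j ^ 2 := by nlinarith
  have hrest : (Finset.univ.erase j).card ≤ ∑ i ∈ Finset.univ.erase j, k i ^ 2 := by
    rw [Finset.card_eq_sum_ones]
    exact Finset.sum_le_sum fun i _ => Nat.one_le_iff_ne_zero.2 (pow_ne_zero 2 (hk i))
  have hcard : (Finset.univ.erase j).card = 2 := by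
    rw [Finset.card_erase_of_mem (Finset.mem_univ j), Finset.card_univ, Fintype.card_fin]
  rw [← Finset.add_sum_erase _ _ (Finset.mem_univ j)]
  omega

/-- `(ℓ/π)² ∑ᵢ (kᵢπ/ℓ)² = |k|²`. [folklore] -/
theorem sineGap_mul_sum_waveNumber_sq (hℓ : ℓ ≠ 0) (k : Fin (d + 1) → ℕ) :
    (ℓ / π) ^ 2 * ∑ i, waveNumber ℓ (k i) ^ 2 = ∑ i, (k i : ℝ) ^ 2 := by
  have hπ : (π : ℝ) ≠ 0 := Real.pi_ne_zero
  rw [Finset.mul_sum]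
  refine Finset.sum_congr rfl fun i _ => ?_
  unfold waveNumber
  field_simp

/-- **The Dirichlet spectral gap of the cube `[0,ℓ]³` in sine form** (`ℝ≥0∞`): for `ℓ > 0` and
`g ∈ C¹(ℝ³; ℂ)` vanishing off the open cube `(0,ℓ)³`,
`6 ∫|g|² ≤ (ℓ/π)² ∫|∇g|² + 3 |∫ u₁ g|²` with the ground mode `u₁(y) = ∏ⱼ √(2/ℓ) sin(πyⱼ/ℓ)`:
sine Parseval, the Dirichlet form identity, `b_k = 0` when some `kⱼ = 0`, `|(1,1,1)|² = 3` and
`|k|² ≥ 6` otherwise — ground energy `3π²/ℓ²`, first excited level `6π²/ℓ²`. [folklore] -/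
theorem sineGap_cube (hℓ : 0 < ℓ) {g : (Fin 3 → ℝ) → ℂ} (hg : ContDiff ℝ 1 g)
    (hgz : ∀ (y : Fin 3 → ℝ) (j : Fin 3), y j ∉ Ioo (0 : ℝ) ℓ → g y = 0) :
    6 * ∫⁻ y in Icc (0 : Fin 3 → ℝ) (fun _ => ℓ), ‖g y‖ₑ ^ 2 ≤
      ENNReal.ofReal ((ℓ / π) ^ 2) *
          (∫⁻ y in Icc (0 : Fin 3 → ℝ) (fun _ => ℓ), ∑ i, ‖fderiv ℝ g y (Pi.single i 1)‖ₑ ^ 2) +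
        3 * ‖∫ y in Icc (0 : Fin 3 → ℝ) (fun _ => ℓ),
          ((∏ j, Real.sqrt (2 / ℓ) * Real.sin (π * y j / ℓ) : ℝ) : ℂ) * g y‖ₑ ^ 2 := by
  have hmode : ∀ y : Fin 3 → ℝ, (∏ j, Real.sqrt (2 / ℓ) * Real.sin (π * y j / ℓ)) =
      ∏ j, Real.sqrt (2 / ℓ) * Real.sin (((1 : Fin 3 → ℕ) j) * π / ℓ * y j) := by
    intro y
    simp only [Pi.one_apply, Nat.cast_one, one_mul, div_mul_eq_mul_div]
  simp_rw [hmode]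
  rw [← sineGap_tsum_enorm_sq_coef hℓ 3 hg.continuous,
    ← sineGap_tsum_sum_waveNumber_sq_mul_enorm_sq_coef hℓ hg hgz, ← ENNReal.tsum_mul_left,
    ← ENNReal.tsum_mul_left]
  conv_lhs => rw [ENNReal.tsum_eq_add_tsum_ite (1 : Fin 3 → ℕ)]
  conv_rhs => rw [ENNReal.tsum_eq_add_tsum_ite (1 : Fin 3 → ℕ)]
  rw [add_right_comm]
  refine add_le_add ?_ (ENNReal.tsum_le_tsum fun k => ?_)
  · rw [← mul_assoc, ← ENNReal.ofReal_mul (sq_nonneg _), sineGap_mul_sum_waveNumber_sq hℓ.ne']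
    have h3 : ENNReal.ofReal (∑ i, (((1 : Fin 3 → ℕ) i : ℕ) : ℝ) ^ 2) = 3 := by
      simp only [Pi.one_apply, Nat.cast_one, one_pow, Finset.sum_const, Finset.card_univ,
        Fintype.card_fin, nsmul_eq_mul, mul_one, Nat.cast_ofNat, ENNReal.ofReal_ofNat]
    rw [h3, ← add_mul]
    gcongr
    norm_num
  · split_ifs with hk1
    · exact le_rfl
    · by_cases hk0 : ∃ j, k j = 0
      · obtain ⟨j, hj⟩ := hk0
        rw [sineGap_coef_eq_zero_of_apply_eq_zero ℓ g hj]
        simp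
      · push Not at hk0
        rw [← mul_assoc, ← ENNReal.ofReal_mul (sq_nonneg _), sineGap_mul_sum_waveNumber_sq hℓ.ne']
        gcongr
        have h6 : ((6 : ℕ) : ℝ) ≤ ∑ i, (k i : ℝ) ^ 2 := by
          exact_mod_cast sineGap_six_le_sum_sq hk0 hk1
        calc (6 : ℝ≥0∞) = ENNReal.ofReal ((6 : ℕ) : ℝ) := by norm_num
          _ ≤ _ := ENNReal.ofReal_le_ofReal h6

/-! ### Transfer to `Space = ℝ³`: the registered stub -/

/-- **Stub — the one-body Dirichlet gap of the cube in sine form.** For `L > 0` and `f ∈ C¹(ℝ³; ℂ)`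
vanishing off the open box `(0,L)³`: `6 ∫|f|² ≤ (L/π)² ∫|∇f|² + 3 |∫ s f|²` with the normalised
ground mode `s(x) = ∏_k √(2/L) sin(π x_k/L)` — i.e. `-Δ_D ≥ 3π²/L² + (3π²/L²)(1 - |s⟩⟨s|)`: the
Dirichlet Laplacian of the cube has ground state `s`, energy `3π²/L²`, and gap `3π²/L²` (sine
Parseval + cosine Parseval of the derivative, tensorised over the three coordinates; `|k|² ≥ 6` for
`k ∈ ℕ₊³ ∖ {(1,1,1)}`), transferred from the coordinate cube to `Space = ℝ³` (`f = 0` off the box,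
so all whole-space integrals live on `Λ_L`, and `∫_Λ |∇f|² ≤ ∫ |∇f|²`). Nearest printed locus: the
Neumann analogue [LSSY2005, Ch. 2, after (2.50)] (`NeumannBox.setLIntegral_box_enorm_sq_le`).
[folklore] -/
theorem stub_sineGap : ∀ (L : ℝ), 0 < L → ∀ f : Space → ℂ, ContDiff ℝ 1 f →
    (∀ x, x ∉ box L → f x = 0) →
    6 * ∫⁻ x, (‖f x‖₊ : ℝ≥0∞) ^ 2 ≤
      ENNReal.ofReal ((L / Real.pi) ^ 2) * (∫⁻ x, gradSqC f x) +
        3 * (‖∫ x, ((∏ k : Fin 3, (Real.sqrt (2 / L) * Real.sin (Real.pi * x k / L)) : ℝ) : ℂ) *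
          f x‖₊ : ℝ≥0∞) ^ 2 := by
  intro L hL f hf hf0
  simp only [gradSqC, ← enorm_eq_nnnorm]
  have h1 : ∫⁻ x in box L, ‖f x‖ₑ ^ 2 = ∫⁻ x, ‖f x‖ₑ ^ 2 := by
    refine setLIntegral_eq_of_support_subset fun x hx => ?_
    by_contra hxb
    simp [hf0 x hxb] at hx
  have h2 : ∫ x in box L, ((∏ k : Fin 3, (Real.sqrt (2 / L) * Real.sin (π * x k / L)) : ℝ) : ℂ) *
        f x =
      ∫ x, ((∏ k : Fin 3, (Real.sqrt (2 / L) * Real.sin (π * x k / L)) : ℝ) : ℂ) * f x :=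
    setIntegral_eq_integral_of_forall_compl_eq_zero fun x hx => by rw [hf0 x hx, mul_zero]
  rw [← h1, ← h2]
  have hg : ContDiff ℝ 1 fun y : Fin 3 → ℝ => f (WithLp.toLp 2 y) := hf.comp PiLp.contDiff_toLp
  have hgz : ∀ (y : Fin 3 → ℝ) (j : Fin 3), y j ∉ Ioo (0 : ℝ) L → f (WithLp.toLp 2 y) = 0 :=
    fun y j hj => hf0 _ fun hx => hj (hx j)
  calc 6 * ∫⁻ x in box L, ‖f x‖ₑ ^ 2
      ≤ ENNReal.ofReal ((L / π) ^ 2) *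
            (∫⁻ x in box L, ∑ k, ‖fderiv ℝ f x (EuclideanSpace.single k 1)‖ₑ ^ 2) +
          3 * ‖∫ x in box L,
            ((∏ k : Fin 3, (Real.sqrt (2 / L) * Real.sin (π * x k / L)) : ℝ) : ℂ) * f x‖ₑ ^ 2 := by
        rw [setLIntegral_box_eq_lintegral_Icc L, setLIntegral_box_eq_lintegral_Icc L,
          setIntegral_box_eq_integral_Icc L]
        simp_rw [← fderiv_comp_toLp_single]
        exact sineGap_cube hL hg hgz
    _ ≤ _ := by
        gcongr
        exact Measure.restrict_le_self


end Summit.AtomisticToContinuum.BoseEinsteinCondensation.Theorems.BaseCoherentMass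

end
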